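import Mathlib
import Literature.MathematicalPhysics.StatisticalMechanics.StablePotentialsProofs
import Summits.AtomisticToContinuum.Crystallization.Theses.ExcessDecayLiouville

/-!
# Route `ExcessDecayLiouville`, support item `ForceBalance` (stmt-AtomisticToContinuum-9335)

GROUND STATES ARE FORCE-BALANCED POINT SETS. For every Lennard-Jones ground state
`x : Fin N → ℝ³` and every particle `p = x i`,
`Σ_{q ∈ range x, q ≠ p} V′(|p − q|) · (p − q)/|p − q| = 0`, stated as a `HasSum` over the finite
subtype `{q // q ∈ range x ∧ q ≠ p}`.

Proof (Fermat / first variation, Blanc–Lewin 2015 §1.2). Move particle `i` alone: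
`F(w) := 𝓔(update x i w)`. Since `x` is injective, `update x i w` is injective for all `w` in a
neighbourhood of `x i` (finitely many points to avoid), and `E(N) ≤ 𝓔` of every injective
configuration (`groundStateEnergy_lennardJones_le`) while `𝓔(x) = E(N)`; so `F` has a local
minimum at `x i`. Removing particle `i` (`interactionEnergy_eq_succAbove_add_siteEnergy`,
`V_LJ(0) = 0` by `0⁻¹ = 0`) writes `F(w) = 𝓔(x ∘ i.succAbove) + Σ_{k ≠ i} V(|w − x k|)`, whose
Fréchet derivative at `x i` is `Σ_{k ≠ i} (V′(dₖ)/dₖ) ⟨x i − x k, ·⟩`, `dₖ = |x i − x k| > 0`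
(`D|w − q| = |p − q|⁻¹⟨p − q, ·⟩` at `p ≠ q`, chain rule). `IsLocalMin.hasFDerivAt_eq_zero` kills
this functional; evaluating it at `u := Σ_{k ≠ i} (V′(dₖ)/dₖ) (x i − x k)` gives `‖u‖² = 0`.
Finally the sum over `k ≠ i` is re-indexed over the subtype of points `q ≠ p` of `range x`
(injectivity of `x`). No explicit formula for `V′` is needed, only differentiability of `V_LJ`
on `(0, ∞)`.
-/

noncomputable section

namespace Summit.AtomisticToContinuum.Crystallization.Theorems

open Literature.MathematicalPhysics.StatisticalMechanics
open Filter Topology Metric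
open scoped RealInnerProductSpace

namespace ExcessDecayLiouvilleForceBalance

variable {d : ℕ}

local notation "𝔼" d => EuclideanSpace ℝ (Fin d)

/-- `D|w − q|(p) = |p − q|⁻¹ ⟨p − q, ·⟩` at `p ≠ q` (derivative of the Euclidean distance to a
fixed point, off that point). [folklore] -/
theorem hasFDerivAt_dist_left {p q : 𝔼 d} (hpq : p ≠ q) :
    HasFDerivAt (fun w : 𝔼 d => dist w q) ((dist p q)⁻¹ • innerSL ℝ (p - q)) p := by
  have hne : ‖p - q‖ ≠ 0 := norm_ne_zero_iff.2 (sub_ne_zero.2 hpq)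
  have hsq : ‖p - q‖ ^ 2 ≠ 0 := pow_ne_zero 2 hne
  have h1 := ((hasFDerivAt_sub_const (x := p) q).norm_sq).sqrt hsq
  have hfun : (fun w : 𝔼 d => √(‖w - q‖ ^ 2)) = fun w => dist w q :=
    funext fun w => by rw [Real.sqrt_sq (norm_nonneg _), dist_eq_norm]
  have key : (1 / (2 * √(‖p - q‖ ^ 2))) •
      ((2 • innerSL ℝ (p - q)).comp (ContinuousLinearMap.id ℝ (𝔼 d))) =
      (dist p q)⁻¹ • innerSL ℝ (p - q) := by
    ext z
    simp only [Real.sqrt_sq (norm_nonneg _), dist_eq_norm, smul_apply,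
      ContinuousLinearMap.comp_apply, ContinuousLinearMap.id_apply, smul_eq_mul, nsmul_eq_mul,
      Nat.cast_ofNat]
    field_simp
  rw [hfun] at h1
  rw [← key]
  exact h1

/-- Chain rule: `D[V(|w − q|)](p) = (V′(d)/d) ⟨p − q, ·⟩`, `d = |p − q| > 0`, whenever `V` is
differentiable at `d`. [folklore] -/
theorem hasFDerivAt_comp_dist_left {V : ℝ → ℝ} {V' : ℝ} {p q : 𝔼 d} (hpq : p ≠ q)
    (hV : HasDerivAt V V' (dist p q)) :
    HasFDerivAt (fun w : 𝔼 d => V (dist w q)) ((V' / dist p q) • innerSL ℝ (p - q)) p := by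
  have h := hV.comp_hasFDerivAt p (hasFDerivAt_dist_left hpq)
  rw [smul_smul, ← div_eq_mul_inv] at h
  exact h

/-- Moving one particle of an injective configuration keeps it injective, for all new positions
in a neighbourhood of the old one. [folklore] -/
theorem eventually_injective_update {N : ℕ} {x : Fin N → 𝔼 d} (hx : Function.Injective x)
    (i : Fin N) : ∀ᶠ w in 𝓝 (x i), Function.Injective (Function.update x i w) := by
  have hev : ∀ᶠ w in 𝓝 (x i), ∀ k : Fin N, k ≠ i → w ≠ x k := by
    refine Filter.eventually_all.2 fun k => ?_
    by_cases hk : k = i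
    · exact Filter.Eventually.of_forall fun w h => (h hk).elim
    · exact (eventually_ne_nhds (hx.ne (Ne.symm hk))).mono fun w hw _ => hw
  refine hev.mono fun w hw a b hab => ?_
  by_cases ha : a = i <;> by_cases hb : b = i
  · exact ha.trans hb.symm
  · subst ha
    rw [Function.update_self, Function.update_of_ne hb] at hab
    exact absurd hab (hw b hb)
  · subst hb
    rw [Function.update_self, Function.update_of_ne ha] at hab
    exact absurd hab.symm (hw a ha)
  · rw [Function.update_of_ne ha, Function.update_of_ne hb] at hab
    exact hx hab

/-- A ground state is a local minimiser of the energy as a function of the position of any one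
of its particles (the others held fixed). [folklore] -/
theorem isLocalMin_update {N : ℕ} {x : Fin N → 𝔼 d} (hx : IsGroundState lennardJones x)
    (i : Fin N) :
    IsLocalMin (fun w => interactionEnergy lennardJones (Function.update x i w)) (x i) := by
  refine (eventually_injective_update hx.1 i).mono fun w hw => ?_
  show interactionEnergy lennardJones (Function.update x i (x i)) ≤
    interactionEnergy lennardJones (Function.update x i w)
  rw [Function.update_eq_self, hx.2]
  exact groundStateEnergy_lennardJones_le hw

/-- Removing the moving particle: `𝓔(update x i w) = 𝓔(x ∘ i.succAbove) + Σ_{k ≠ i} V(|w − x k|)`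
for `V_LJ` (`V_LJ 0 = 0`). [folklore] -/
theorem interactionEnergy_update_eq {n : ℕ} (x : Fin (n + 1) → 𝔼 d) (i : Fin (n + 1)) (w : 𝔼 d) :
    interactionEnergy lennardJones (Function.update x i w) =
      interactionEnergy lennardJones (x ∘ i.succAbove) +
        ∑ k ∈ Finset.univ.erase i, lennardJones (dist w (x k)) := by
  rw [interactionEnergy_eq_succAbove_add_siteEnergy lennardJones lennardJones_zero _ i]
  have hcomp : Function.update x i w ∘ i.succAbove = x ∘ i.succAbove :=
    funext fun b => by
      simp only [Function.comp_apply, Function.update_of_ne (Fin.succAbove_ne i b)]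
  rw [hcomp]
  congr 1
  unfold siteEnergy
  refine Finset.sum_congr rfl fun k hk => ?_
  rw [Function.update_self, Function.update_of_ne (Finset.ne_of_mem_erase hk)]

/-- The Lennard-Jones potential is differentiable on `(0, ∞)` (indeed off `0`). [folklore] -/
theorem differentiableAt_lennardJones {r : ℝ} (hr : r ≠ 0) :
    DifferentiableAt ℝ lennardJones r := by
  have h : lennardJones = fun r : ℝ => (1 / 12) * (r⁻¹) ^ 12 - (1 / 6) * (r⁻¹) ^ 6 :=
    funext fun r => rfl
  rw [h]
  fun_prop (disch := exact hr)

/-- **Force balance at one particle**, index form: for a Lennard-Jones ground state `x` and a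
particle `i`, `Σ_{k ≠ i} (V′(dₖ)/dₖ) (x i − x k) = 0`, `dₖ = |x i − x k|`. [folklore] -/
theorem sum_erase_force_eq_zero {N : ℕ} {x : Fin N → 𝔼 d} (hx : IsGroundState lennardJones x)
    (i : Fin N) :
    ∑ k ∈ Finset.univ.erase i,
      (deriv lennardJones (dist (x i) (x k)) / dist (x i) (x k)) • (x i - x k) = 0 := by
  obtain ⟨n, rfl⟩ : ∃ n, N = n + 1 := Nat.exists_eq_succ_of_ne_zero (Nat.pos_iff_ne_zero.1 i.pos)
  set p : 𝔼 d := x i with hp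
  -- the coefficients and the force
  set c : Fin (n + 1) → ℝ := fun k => deriv lennardJones (dist p (x k)) / dist p (x k) with hc
  -- the derivative of `F`
  have hne : ∀ k ∈ Finset.univ.erase i, p ≠ x k := fun k hk h =>
    Finset.ne_of_mem_erase hk (hx.1 h).symm
  have hF : HasFDerivAt (fun w => interactionEnergy lennardJones (Function.update x i w))
      (∑ k ∈ Finset.univ.erase i, c k • innerSL ℝ (p - x k)) p := by
    have hfun : (fun w => interactionEnergy lennardJones (Function.update x i w)) = fun w =>
        interactionEnergy lennardJones (x ∘ i.succAbove) +
          ∑ k ∈ Finset.univ.erase i, lennardJones (dist w (x k)) :=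
      funext fun w => interactionEnergy_update_eq x i w
    rw [hfun]
    refine HasFDerivAt.const_add _ (HasFDerivAt.fun_sum fun k hk => ?_)
    have hd : dist p (x k) ≠ 0 := dist_ne_zero.2 (hne k hk)
    exact hasFDerivAt_comp_dist_left (hne k hk) (differentiableAt_lennardJones hd).hasDerivAt
  -- Fermat
  have hzero := (isLocalMin_update hx i).hasFDerivAt_eq_zero hF
  -- evaluate the vanishing functional at the force itself
  set u : 𝔼 d := ∑ k ∈ Finset.univ.erase i, c k • (p - x k) with hu
  have heval : (∑ k ∈ Finset.univ.erase i, c k • innerSL ℝ (p - x k)) u = ⟪u, u⟫ := by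
    rw [sum_apply, hu, sum_inner]
    refine Finset.sum_congr rfl fun k _ => ?_
    rw [smul_apply, innerSL_apply_apply, inner_smul_left, smul_eq_mul]
    rfl
  rw [hzero, zero_apply] at heval
  exact inner_self_eq_zero.1 heval.symm

end ExcessDecayLiouvilleForceBalance

open ExcessDecayLiouvilleForceBalance in
/-- **ForceBalance** (route `ExcessDecayLiouville`, item stmt-AtomisticToContinuum-9335): every
Lennard-Jones ground state is a force-balanced point set — for every particle `p ∈ range x`,
`Σ_{q ∈ range x, q ≠ p} (V′_LJ(|p − q|)/|p − q|) (p − q) = 0` as a `HasSum` over the finite subtype.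
Fermat at a minimum over the open set of injective configurations (Blanc–Lewin 2015, §1.2).
[folklore] -/
theorem forceBalance_proof :
    Summit.AtomisticToContinuum.Crystallization.Theses.ExcessDecayLiouville.ForceBalance := by
  intro N x hx p hp
  obtain ⟨i, rfl⟩ := hp
  classical
  -- the finite set of other points
  set s : Finset (EuclideanSpace ℝ (Fin 3)) := (Finset.univ.erase i).image x with hs
  have hmem : ∀ q, q ∈ s ↔ q ∈ Set.range x ∧ q ≠ x i := fun q => by
    simp only [hs, Finset.mem_image, Finset.mem_erase, Finset.mem_univ, and_true, Set.mem_range]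
    constructor
    · rintro ⟨k, hk, rfl⟩
      exact ⟨⟨k, rfl⟩, fun h => hk (hx.1 h)⟩
    · rintro ⟨⟨k, rfl⟩, hk⟩
      exact ⟨k, fun h => hk (h ▸ rfl), rfl⟩
  haveI : Fintype {q : EuclideanSpace ℝ (Fin 3) // q ∈ Set.range x ∧ q ≠ x i} :=
    Fintype.subtype s hmem
  set g : EuclideanSpace ℝ (Fin 3) → EuclideanSpace ℝ (Fin 3) := fun q =>
    (deriv lennardJones (dist (x i) q) / dist (x i) q) • (x i - q) with hg
  have hsum : ∑ q : {q : EuclideanSpace ℝ (Fin 3) // q ∈ Set.range x ∧ q ≠ x i}, g q = 0 := by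
    rw [← Finset.sum_subtype s hmem g, hs, Finset.sum_image fun a _ b _ h => hx.1 h]
    exact sum_erase_force_eq_zero hx i
  have h := hasSum_fintype fun q : {q : EuclideanSpace ℝ (Fin 3) // q ∈ Set.range x ∧ q ≠ x i} =>
    g q
  rw [hsum] at h
  exact h

end Summit.AtomisticToContinuum.Crystallization.Theorems

end
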